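import Literature.MathematicalPhysics.QuantumFieldTheory.Dimock2011to13.UrsellTreeGraphBound
import Mathlib.Data.Fin.Tuple.Sort
import Mathlib.Analysis.Complex.Exponential

/-!
# Dimock, *The renormalization group according to Balaban* I, Appendix B, proof of THEOREM `\label{cluster}`, STEP 4 —
# THE SUMMATION OVER THE TUPLES COMPATIBLE WITH A TREE GRAPH, (sundry) → (spit1), and the bound on the `n`-th term
# of (hstar) — PROVED, abstractly (any finite polymer set, weights, volumes, overlap relation) and in Dimock's form

**Citation header (reproduction of PUBLISHED work; template of the Bałaban lattice Yang–Mills cell).**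
J. Dimock, *The renormalization group according to Balaban I. Small fields*, Rev. Math. Phys. **25** (2013) 1330010
(= arXiv:1108.1335v2) [Dimock2013], Appendix B "cluster expansion", proof of THEOREM `\label{cluster}` (#27), step 4,
TeX L3405–3511: (sundry) L3417–3426, the use of (owl) and (clams) L3430–3438, the relabeling L3450–3451, the
summation vertex by vertex L3452–3478, (spit1) L3480–3484, (spit2) L3487–3500, *"divide by n! and sum over n"*
L3504–3511.  TeX line numbers refer to the arXiv source held by the cell (`inputs/files/dimock/src/1108.1335/1108.1335.tex`);
every quotation below was read there this session.  Dimock's papers are published and refereed and are the cell's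
TEMPLATE, not manuscripts under audit; no quantity of the Bałaban series is touched.

**What the paper prints (verbatim).**  (sundry), L3416–3426: *"Now fix n and Y and let us restrict to sums over
(Y_1, …, Y_n) such that ∪_i Y_i = Y. Σ_{(Y_1,…,Y_n)} ρ^T(Y_1,…,Y_n) Π_i K^#(Y_i) ≤ Σ_g Σ_{(Y_1,…,Y_n) → g} ρ^T(Y_1,…,Y_n)
Π_i K^#(Y_i) ≤ Σ_g Σ_{(Y_1,…,Y_n) → g} Σ_{τ ⊂ g} Π_i K^#(Y_i) = Σ_τ Σ_{g ⊃ τ} Σ_{(Y_1,…,Y_n) → g} Π_i K^#(Y_i) = Σ_τ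
Σ_{(Y_1,…,Y_n) → g: g ⊃ τ} Π_i K^#(Y_i)"*.  L3450–3468: *"After relabeling a tree graph τ can be thought of as a map
τ from (1, …, n) to itself such that τ(j) < j. The restrictions in the sum over (Y_1, …, Y_n) are then that Y_j ∩
Y_{τ(j)} ≠ ∅. For the sum over Y_n we we have by (sudsy) Σ_{Y_n ∩ Y_{τ(n)} ≠ ∅} e^{−2κ₀ d_M(Y_n)} ≤ K₀|Y_{τ(n)}|_M
Continue summing over Y_{n−1}, Y_{n−2}, …. By the time we get to the j^{th} vertex we will have accumulated a factor
|Y_j|^{τ^{−1}(j)} = |Y_j|^{d_j−1} where d_j is the incidence number at j for τ. Then we estimate Σ_{Y_j ∩ Y_{τ(j)} ≠ ∅}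
e^{−2κ₀d_M(Y_j)} |Y_j|_M^{d_j−1} ≤ (d_j−1)! Σ_{Y_j ∩ Y_{τ(j)} ≠ ∅} e^{−2κ₀d_M(Y_j)}e^{|Y_j|_M} ≤ (d_j−1)! K₀e^{κ₀}
|Y_{τ(j)}| Here we used again |Y_j|_M ≤ κ₀(1 + d_M(Y_j))"*; L3470–3478: *"The last step is Σ_{Y_1 ⊂ Y} e^{−2κ₀
d_M(Y_1)}|Y_1|_M^{d_1−1} ≤ (d_1−1)! Σ_{Y_1 ⊂ Y} e^{−2κ₀d_M(Y_j)}e^{|Y_1|_M} ≤ (d_1−1)! K₀e^{κ₀}|Y|_M ≤ (d_1−1)!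
K₀κ₀e^{κ₀}e^{d_M(Y)}"*; (spit1), L3480–3484: *"Combining the above yields |Σ_{(Y_1,…,Y_n)} ρ^T(Y_1,…,Y_n) Π_i
K^#(Y_i)| ≤ e^{−(κ₂−2κ₀−1)d_M(Y)} (O(1)H₀)^n Σ_τ Π_{j=1}^n (d_j−1)!"*; L3504–3509: *"Now use (spit2) in (spit1), divide
by n! and sum over n to get a bound on H^#(Y). We have |H^#(Y)| ≤ e^{−(κ₂−2κ₀−1)d_M(Y)} Σ_{n=1}^∞ (O(1)H₀)^n ≤ O(1)H₀
e^{−(κ₂−2κ₀−1)d_M(Y)} provided H₀ ≤ c₀ and c₀ is sufficiently small."*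

**What is reproduced here (kernel-checked, zero `sorry`).**  The COMBINATORIAL ENGINE of step 4 — the summation over
the `n`-tuples compatible with a tree graph, vertex by vertex from the leaves — stated ABSTRACTLY for a finite set `Q`
of "polymers" of any type `P`, weights `w ≥ 0`, volumes `vol ≥ 0`, a relation `ov` ("overlap") and two constants
`A ≥ 0`, `B` subject to the VERTEX HYPOTHESIS `Σ_{X ∈ Q: X ov X'} w(X)·vol(X)^k ≤ k!·A·vol(X')` (all `X' ∈ Q`, all
`k`) and the ROOT HYPOTHESIS `Σ_{X∈Q} w(X)·vol(X)^k ≤ k!·A·B` (all `k`), and then in Dimock's form, on top of the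
sibling `UrsellTreeGraphBound` (`ρ^T`, the overlap graph `g`, tree graphs as parent maps, *"|ρ^T| ≤ number of tree
graphs contained in g"*, (spit2)) and `Literature.Combinatorics.Enumerative.{CayleyForests, CayleyDegreeFormula}`.
* §1 ORDERED TREE GRAPHS (L3450–3451): `τ : ℕ → ℕ` with `τ j < j`, vertices `0, …, n−1` (root `0` = Dimock's `1`),
  `Compat ov τ Y` (*"Y_j ∩ Y_{τ(j)} ≠ ∅"*), the child counts `childCount τ n k = |τ^{-1}(k)|`, the tree sum
  `treeSum ov τ Q w vol n m = Σ_{Y ∈ Q^n compatible} Π_j w(Y_j) vol(Y_j)^{m_j}` (exponents `m` = the volume factors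
  *"accumulated"* so far), and **`treeSum_le`**: `treeSum (n+1) m ≤ A^{n+1}·B·Π_j (m_j + |τ^{-1}(j)|)!` — induction on
  `n`, summing out the last vertex (always a leaf) with the vertex hypothesis (`compat_snoc_iff`, `childCount_succ`,
  `childCount_self`), the root with the root hypothesis.
* §2 THE HYPOTHESES FROM (sudsy) AND (ninety) (L3457–3478): `weight_mul_pow_le` (`e^{−2κ₀d}vol^k ≤ k!e^{κ₀}e^{−κ₀d}`
  from `vol ≤ κ₀(1+d)`, via `x^k ≤ k!e^x`), **`vertexHyp_of_sudsy`** (`A = K₀e^{κ₀}`), **`rootHyp_of_sudsy`**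
  (`B = κ₀e^{d_M(Y)}`, via `1 + x ≤ e^x`).
* §3 RELABELING (L3450 *"After relabeling"*): **`exists_relabel`** — every tree graph on the indices `Fin n` rooted at
  `0` (parent map `t`, `IsForestOn univ {0} t`) is conjugate by a permutation `σ` fixing `0` to an ordered one
  (`σ⁻¹(t(σ j)) < j` for `j ≠ 0`): sort the indices by depth (Mathlib `Tuple.sort`).
* §4 **`sum_compat_le`**: for EVERY tree graph `t` on `Fin n` (`n ≥ 1`), `Σ_{Y ∈ Q^n: Y_u ov Y_{t(u)} ∀ u ≠ 0} Π_j
  w(Y_j)vol(Y_j)^{m_j} ≤ A^n·B·Π_u (m_u + #children_u(t))!` (§1 transported along §3); `prod_card_children_factorial_le`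
  and **`sum_forests_prod_card_children_factorial_le`** (`Σ_{trees on V rooted at v} Π_u #children_u! ≤ (|V|−1)!·
  4^{|V|−1}`, from (spit2) = `CayleyDegreeFormula.sum_trees_prod_factorial_le`); **`sum_abs_rhoT_mul_prod_le`** — THE
  BOUND ON THE `n`-TH TERM: for cube-set polymers and the overlap relation `X ∩ X' ≠ ∅`, `Σ_{(Y_j)∈Q^n} |ρ^T(Y_1,…,Y_n)|
  Π_j w(Y_j) ≤ A^n·B·(n−1)!·4^{n−1}` ((sundry): *"|ρ^T| ≤ number of tree graphs contained in g"* =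
  `UrsellTreeGraphBound.abs_rhoT_le_card_treeGraphs`, exchange of the two sums, `sum_compat_le` per tree graph);
  **`step4_term_le`** — Dimock's instance (`w = e^{−2κ₀d_M}`, `A = K₀e^{κ₀}`, `B = κ₀e^{d_M(Y)}`, hypotheses (sudsy) on
  `Q` and for `Y`, (ninety)); **`hstar_partialSum_le`** — *"divide by n! and sum over n"*: for `A ≤ 1/8` every partial
  sum of `Σ_n (1/n!)·(n-th term)` is `≤ 2AB` (the `n`-th term is `≤ AB(4A)^{n−1}`).
* §5 (v1.1) THE HYPOTHESES FROM AN ANCHORED BOUND — the mechanism of (sudsy)'s own proof (App. A =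
  `\section{estimates}`, Cor. `\label{cranberry}`, proof L3150–3156: *"Σ_{X: X ∩ Y ≠ ∅} e^{−a|X|} ≤ Σ_{□ ⊂ Y} Σ_{X ⊃ □}
  e^{−a|X|} ≤ b|Y|"*): **`sum_overlap_le_of_anchored`** (an anchored bound `Σ_{X∈Q: q∈X} f(X) ≤ Φ` for every cube
  `q` gives `Σ_{X∈Q: X∩X'≠∅} f(X) ≤ Φ·|X'|`), **`vertexHyp_of_anchored`** ∕ **`rootHyp_of_anchored`** (the vertex and
  root hypotheses with `vol = |·|`, `A = Φ`, `B = |Y|` from an ANCHORED EXPONENTIAL NORM `Σ_{X∈Q: q∈X} w(X)e^{|X|} ≤ Φ`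
  — the form of the Bałaban-side activity norms), **`sum_abs_rhoT_mul_prod_le_of_anchored`** (`Σ_{(Y_j)∈Q^n}
  |ρ^T|·Π_j w(Y_j) ≤ Φ^n·|Y|·(n−1)!·4^{n−1}` when every polymer of `Q` meets `Y`).  Added on the NE5 formalisation
  crew's welcome of an identification lemma between the overlap-sum hypotheses here and their anchored norm
  (`Summits/…/T4Continuum/Support/UrsellTreeSum`, journal l.6653) — nothing of that file is imported or restated.

**INFO (kernel-backed; harmless to the theorem).**  L3458–3459 print the factor accumulated at the `j`-th vertex as
*"|Y_j|^{τ^{−1}(j)} = |Y_j|^{d_j−1} where d_j is the incidence number at j for τ"* and L3470–3478 use `|Y_1|^{d_1−1}`,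
`(d_1−1)!` at the last vertex `1`.  For `j ≥ 2` indeed `|τ^{-1}(j)| = d_j − 1` (the children; the remaining edge goes
to the parent), but AT THE ROOT `1` every incident edge comes from a child: `|τ^{-1}(1)| = d_1` (already for `n = 2`:
the sum over `Y_2 ∩ Y_1 ≠ ∅` produces `K₀|Y_1|_M^1`, exponent `1 = d_1`, not `d_1 − 1 = 0`).  So the last step carries
`d_1!` and (spit1) reads `… Σ_τ d_1·Π_{j=1}^n (d_j−1)!` — here `treeSum_le`∕`sum_compat_le` carry the exact factor
`Π_u #children_u!` (`= #children_v · Π_u (d_u−1)!`, `prod_card_children_factorial_le`), bounded using `d_1 ≤ n − 1`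
by `(n−1)·(n−2)!·4^{n−1} = (n−1)!·4^{n−1}` (`sum_forests_prod_card_children_factorial_le`).  After division by `n!`
the `n`-th term is `≤ A^n B 4^{n−1}/n ≤ AB(4A)^{n−1}` instead of the printed `(O(1)H₀)^n`-geometric term: the series
still converges geometrically for `A` small and (sunshine0) `|H^#(Y)| ≤ O(1)H₀e^{−(κ−3κ₀−3)d_M(Y)}` is unaffected
(`hstar_partialSum_le`).  Recorded, not graded (TEMPLATE.md §4.1 row «D1 §4.6»).

**Readings (declared).**  (i) The tuple sum is over ALL `n`-tuples from a finite polymer set `Q` (Dimock: the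
polymers inside the fixed `Y`; his constraint `∪_i Y_i = Y` is dropped on the majorant side exactly as he does, L3416
*"let us restrict to sums"* then (sundry)'s first `≤`); the model-specific inputs — (owl) `|K^#(Y_i)| ≤ O(1)H₀
e^{−κ₂d_M(Y_i)}`, (clams) and the extraction of `e^{−(κ₂−2κ₀)d_M(Y)}` (L3430–3438), (sudsy), (ninety) — enter only as
the HYPOTHESES of §2∕§4 (`hsudsy`, `hninety`, …); nothing about `d_M` is proved here.  (ii) Tree graphs are parent
maps towards the root index `0` (`UrsellTreeGraphBound` reading (i)); Dimock's relabeled form `τ(j) < j` is §1 and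
the relabeling itself §3.  (iii) `ρ^T` as in `UrsellTreeGraphBound` (reading (ii) there: the solution of (sunset) =
the printed connected-graph sum, `rhoT_eq_sum_graphs`).  (iv) The exchange *"Σ_g Σ_{(Y)→g} Σ_{τ⊂g} = Σ_τ Σ_{(Y)→g ⊃
τ}"* of (sundry) is the exchange of the sum over tuples with the sum over ALL tree graphs on the indices of the
indicator `[τ ⊂ g(Y)]` (`Finset.sum_comm`); `τ ⊂ g(Y)` is `Y_u ∩ Y_{t(u)} ≠ ∅ ∀ u ≠ 0`.

**What is NOT claimed.**  (owl), (clams), (sudsy), (ninety) themselves (hypotheses here; (sudsy) is [Dimock2013]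
Cor. `\label{cranberry}` of App. A, (ninety) eq. (ninety) quoting [Bal98b]); the identification of the abstract `Q`,
`vol = |·|_M`, `d_M` with the tree's `M`-polymer vocabulary of `…Dimock2011to13.{SteinerLengthSums, MayerExpansion,
Phi43PolymerRepresentation}` (not imported; no statement about them); the full THEOREM `\label{cluster}` ∕ (sunshine0)
assembly with steps 1–3 (the Bałaban-side cell has the polymer-representation and Kotecký–Preiss apparatus:
`Phi43PolymerRepresentation`, `Balaban1983to89/B13Resummation` — untouched); infinite sums (only partial sums are
bounded, which is what absolute convergence needs); anything of B1–B16 (TEMPLATE.md §4.1 row «D1 §4.6» ↔ B12∕B13 —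
grade there).  NOT summit progress; NOT a statement about any Bałaban paper; NOT continuum; NOT Clay.  Imports the
sibling `…Dimock2011to13.UrsellTreeGraphBound` (v1.2; which imports `HardCoreUrsell`, `CayleyForests`,
`UrsellConnectedGraphSum`, `CayleyDegreeFormula` — it does not import this file; no cycle; no Summits import) and
Mathlib (`Data.Fin.Tuple.Sort`, `Analysis.Complex.Exponential`); sub-namespace `…Dimock2011to13.TreeGraphSummation`;
modifies nothing.  Unit `b2b-balaban-template` gen 33 (journal CLAIM D1-TREE-SUMMATION-KERNEL); cell records
TEMPLATE.md §4.1 row «D1 §4.6», §15.2; GAPS C-tmpl33-4 (v1), C-tmpl33-5 (v1.1).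

**Version.**  v1 (unit `b2b-balaban-template` gen 33, p209323, commit f2a8c559d148).  v1.1 (same unit and gen, journal CLAIM
D1-TREE-SUMMATION-KERNEL round 3b) — ADDITIVE to v1: + §5 (`sum_overlap_le_of_anchored`, `vertexHyp_of_anchored`,
`rootHyp_of_anchored`, `sum_abs_rhoT_mul_prod_le_of_anchored`); header bullet §5 and this line; every v1 declaration
byte-identical.
-/

noncomputable section

open Finset

namespace Literature.MathematicalPhysics.QuantumFieldTheory.Dimock2011to13.TreeGraphSummation

/-! ## §1 Ordered tree graphs `τ(j) < j` and the sum over the tuples compatible with one -/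

section Ordered

variable {P : Type*} (ov : P → P → Prop) [DecidableRel ov] (τ : ℕ → ℕ)

/-- compatibility of an `n`-tuple `Y` (indices `0, …, n−1`, root `0`) with the ordered tree graph `τ`:
*"The restrictions in the sum over (Y_1, …, Y_n) are then that Y_j ∩ Y_{τ(j)} ≠ ∅"* — here `ov (Y j) (Y (τ j))`
for every non-root index `j`. [cite: Dimock2013, App. B Theorem cluster, proof step 4 (arXiv:1108.1335v2 TeX L3450–3451)] -/
def Compat {n : ℕ} (Y : Fin n → P) : Prop :=
  ∀ i j : Fin n, 0 < (j : ℕ) → τ j = (i : ℕ) → ov (Y j) (Y i)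

/-- compatibility is decidable. [cite: Dimock2013, App. B Theorem cluster, proof step 4 (arXiv:1108.1335v2 TeX L3450–3451)] -/
instance instDecidableCompat {n : ℕ} (Y : Fin n → P) : Decidable (Compat ov τ Y) := by
  unfold Compat; infer_instance

/-- the number of children `|τ^{-1}(k)|` of the vertex `k` among the vertices `1, …, n−1` of the ordered tree graph
`τ`. [cite: Dimock2013, App. B Theorem cluster, proof step 4 (arXiv:1108.1335v2 TeX L3450–3459)] -/
def childCount (n k : ℕ) : ℕ := ((univ : Finset (Fin n)).filter fun i : Fin n => 0 < (i : ℕ) ∧ τ i = k).card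

variable (Q : Finset P) (w vol : P → ℝ)

/-- the TREE SUM of the ordered tree graph `τ` over `n`-tuples of polymers from `Q`, with weights `w` and volume
exponents `m`: `Σ_{(Y_j) ∈ Q^n compatible with τ} Π_j w(Y_j)·vol(Y_j)^{m_j}` (Dimock: `w = e^{−2κ₀ d_M}`, `vol = |·|_M`,
the exponents accumulated while *"summing over Y_n, Y_{n−1}, …"*). [cite: Dimock2013, App. B Theorem cluster, proof step 4 (arXiv:1108.1335v2 TeX L3450–3468)] -/
def treeSum (n : ℕ) (m : ℕ → ℕ) : ℝ :=
  ∑ Y ∈ Fintype.piFinset (fun _ : Fin n => Q), if Compat ov τ Y then ∏ j, w (Y j) * vol (Y j) ^ m j else 0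

/-- splitting off the LAST coordinate of a sum over `Q^{n+1}`. [folklore] -/
private theorem sum_piFinset_succ {α M : Type*} [AddCommMonoid M] {n : ℕ} (Q : Finset α)
    (G : (Fin (n + 1) → α) → M) :
    ∑ f ∈ Fintype.piFinset (fun _ : Fin (n + 1) => Q), G f =
      ∑ g ∈ Fintype.piFinset (fun _ : Fin n => Q), ∑ a ∈ Q, G (Fin.snoc g a) := by
  rw [← Finset.sum_product' (f := fun g a => G (Fin.snoc g a))]
  refine Finset.sum_equiv ((Fin.snocEquiv fun _ => α).symm.trans (Equiv.prodComm _ _)) (fun f => ?_)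
    (fun f _ => ?_)
  · rw [Fin.mem_piFinset_iff_last_init, Finset.mem_product]
    simp [and_comm, Fin.init, Fin.snocEquiv, Equiv.prodComm]
  · simp [Fin.snocEquiv, Equiv.prodComm, Fin.snoc_init_self]

variable {ov τ Q w vol}

/-- the last vertex of an ordered tree graph has no children. [cite: Dimock2013, App. B Theorem cluster, proof step 4 (arXiv:1108.1335v2 TeX L3450–3459)] -/
theorem childCount_self (hτ : ∀ j, 0 < j → τ j < j) (n : ℕ) : childCount τ (n + 1) n = 0 := by
  rw [childCount, Finset.card_eq_zero, Finset.filter_eq_empty_iff]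
  rintro i - ⟨hi, hin⟩
  have h1 := hτ i hi
  have h2 := i.isLt
  omega

/-- child counts of the first `n + 1` vertices versus the first `n`: only the parent `τ n` of the new vertex `n ≥ 1`
gains a child. [cite: Dimock2013, App. B Theorem cluster, proof step 4 (arXiv:1108.1335v2 TeX L3450–3459)] -/
theorem childCount_succ (n k : ℕ) :
    childCount τ (n + 1) k = childCount τ n k + if 0 < n ∧ τ n = k then 1 else 0 := by
  simp only [childCount, Finset.card_filter]
  rw [Fin.sum_univ_castSucc]
  simp only [Fin.val_castSucc, Fin.val_last]
  congr 1

omit [DecidableRel ov] in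
/-- compatibility of an `(n+1)`-tuple, `n ≥ 1`: the first `n` entries are compatible and the last one is related to
the entry at its parent `τ n`. [cite: Dimock2013, App. B Theorem cluster, proof step 4 (arXiv:1108.1335v2 TeX L3450–3453)] -/
theorem compat_snoc_iff (hτ : ∀ j, 0 < j → τ j < j) {n : ℕ} (hn : 0 < n) (Y : Fin n → P) (a : P) :
    Compat ov τ (Fin.snoc Y a : Fin (n + 1) → P) ↔ Compat ov τ Y ∧ ov a (Y ⟨τ n, hτ n hn⟩) := by
  constructor
  · intro h
    refine ⟨fun i j hj hij => ?_, ?_⟩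
    · have := h i.castSucc j.castSucc (by simpa using hj) (by simpa using hij)
      simpa [Fin.snoc_castSucc] using this
    · have := h (Fin.castSucc ⟨τ n, hτ n hn⟩) (Fin.last n) (by simp [hn]) (by simp)
      rw [Fin.snoc_castSucc, Fin.snoc_last] at this
      exact this
  · rintro ⟨h, ha⟩ i j hj hij
    rcases Fin.eq_castSucc_or_eq_last j with ⟨j, rfl⟩ | rfl
    · rcases Fin.eq_castSucc_or_eq_last i with ⟨i, rfl⟩ | rfl
      · simp only [Fin.val_castSucc] at hj hij
        rw [Fin.snoc_castSucc, Fin.snoc_castSucc]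
        exact h i j hj hij
      · exfalso
        simp only [Fin.val_castSucc, Fin.val_last] at hj hij
        have h1 := hτ j hj
        have h2 := j.isLt
        omega
    · simp only [Fin.val_last] at hij
      have hi : i = Fin.castSucc ⟨τ n, hτ n hn⟩ := Fin.ext (by simp [← hij])
      subst hi
      rw [Fin.snoc_castSucc, Fin.snoc_last]
      exact ha

/-- the tree sum is a sum of nonnegative terms. [cite: Dimock2013, App. B Theorem cluster, proof step 4 (arXiv:1108.1335v2 TeX L3450–3468)] -/
theorem treeSum_summand_nonneg (hw : ∀ X ∈ Q, 0 ≤ w X) (hvol : ∀ X ∈ Q, 0 ≤ vol X) {n : ℕ} (m : ℕ → ℕ)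
    {Y : Fin n → P} (hY : Y ∈ Fintype.piFinset fun _ : Fin n => Q) :
    0 ≤ (if Compat ov τ Y then ∏ j, w (Y j) * vol (Y j) ^ m j else 0 : ℝ) := by
  split_ifs
  · exact Finset.prod_nonneg fun j _ =>
      mul_nonneg (hw _ (Fintype.mem_piFinset.1 hY j)) (pow_nonneg (hvol _ (Fintype.mem_piFinset.1 hY j)) _)
  · exact le_rfl

/-- **THE SUMMATION OVER THE TUPLES COMPATIBLE WITH AN ORDERED TREE GRAPH** ((sundry)→(spit1), L3450–3478: *"For the
sum over Y_n we have by (sudsy) Σ_{Y_n ∩ Y_τ(n) ≠ ∅} e^{−2κ₀d_M(Y_n)} ≤ K₀|Y_τ(n)|_M Continue summing over Y_{n−1},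
Y_{n−2}, …. By the time we get to the j^th vertex we will have accumulated a factor |Y_j|^{τ^{-1}(j)} … Then we estimate
Σ_{Y_j ∩ Y_τ(j) ≠ ∅} e^{−2κ₀d_M(Y_j)}|Y_j|_M^{d_j−1} ≤ (d_j−1)! Σ … e^{−2κ₀d_M(Y_j)}e^{|Y_j|_M} ≤ (d_j−1)! K₀e^{κ₀}|Y_τ(j)|
… The last step is Σ_{Y_1 ⊂ Y} …"*), ABSTRACTLY: for polymers `Q`, weights `w ≥ 0`, volumes `vol ≥ 0`, a relation
`ov` and constants `A ≥ 0`, `B` with the VERTEX HYPOTHESIS `Σ_{X ∈ Q, X ov X'} w(X) vol(X)^k ≤ k!·A·vol(X')` (every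
`X' ∈ Q`, every `k`) and the ROOT HYPOTHESIS `Σ_{X∈Q} w(X) vol(X)^k ≤ k!·A·B` (every `k`), the tree sum of an ordered
tree graph `τ` on `n + 1` vertices with exponents `m` is at most `A^{n+1}·B·Π_j (m_j + |τ^{-1}(j)|)!` — by induction
on `n`, summing out the last vertex (a leaf) first.  With `m = 0` the accumulated factorials are `Π_j |τ^{-1}(j)|!`
(`= (d_j − 1)!` off the root, `= d_1!` AT the root — see the module docstring's INFO).
[cite: Dimock2013, App. B Theorem cluster, proof step 4 (arXiv:1108.1335v2 TeX L3450–3484)] -/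
theorem treeSum_le (hτ : ∀ j, 0 < j → τ j < j) (hw : ∀ X ∈ Q, 0 ≤ w X) (hvol : ∀ X ∈ Q, 0 ≤ vol X) {A B : ℝ}
    (hA : 0 ≤ A)
    (H1 : ∀ X' ∈ Q, ∀ k : ℕ, ∑ X ∈ Q with ov X X', w X * vol X ^ k ≤ k.factorial * A * vol X')
    (H0 : ∀ k : ℕ, ∑ X ∈ Q, w X * vol X ^ k ≤ k.factorial * A * B) (n : ℕ) (m : ℕ → ℕ) :
    treeSum ov τ Q w vol (n + 1) m ≤
      A ^ (n + 1) * B * ∏ j : Fin (n + 1), ((m j + childCount τ (n + 1) j).factorial : ℝ) := by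
  induction n generalizing m with
  | zero =>
    -- a single vertex, the root: the root hypothesis with exponent `m 0`
    have h1 : treeSum ov τ Q w vol 1 m = ∑ a ∈ Q, w a * vol a ^ m 0 := by
      rw [treeSum, sum_piFinset_succ, Fintype.piFinset_of_isEmpty, Fintype.sum_unique]
      refine Finset.sum_congr rfl fun a _ => ?_
      have hc : Compat ov τ (Fin.snoc (default : Fin 0 → P) a : Fin 1 → P) :=
        fun i j hj _ => absurd hj (by simp)
      have h0 : (Fin.snoc (default : Fin 0 → P) a : Fin 1 → P) 0 = a :=
        Fin.snoc_last (α := fun _ => P) (x := a) (p := default)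
      rw [if_pos hc, Fin.prod_univ_one, h0, Fin.val_zero]
    rw [h1, Fin.prod_univ_one]
    simp only [Fin.isValue, Fin.val_zero, childCount_self hτ 0, add_zero]
    calc ∑ a ∈ Q, w a * vol a ^ m 0 ≤ (m 0).factorial * A * B := H0 (m 0)
      _ = A ^ (0 + 1) * B * ((m 0).factorial : ℝ) := by ring
  | succ n ih =>
    -- `N = n + 1 ≥ 1` old vertices, the new vertex `N` is a leaf with parent `p = τ N`
    set N := n + 1 with hN
    have hNpos : 0 < N := Nat.succ_pos n
    set p : Fin N := ⟨τ N, hτ N hNpos⟩ with hp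
    -- the exponents after summing out the vertex `N`: its parent gains one volume factor
    set m' : ℕ → ℕ := fun k => if k = τ N then m k + 1 else m k with hm'
    -- step 1: sum out the last vertex
    have hstep : treeSum ov τ Q w vol (N + 1) m ≤ (m N).factorial * A * treeSum ov τ Q w vol N m' := by
      rw [treeSum, sum_piFinset_succ, treeSum, Finset.mul_sum]
      refine Finset.sum_le_sum fun Y hY => ?_
      have hYp : Y p ∈ Q := Fintype.mem_piFinset.1 hY p
      -- the summand at `snoc Y a` factorises
      have hfac : ∀ a ∈ Q, (if Compat ov τ (Fin.snoc Y a : Fin (N + 1) → P) then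
            ∏ j : Fin (N + 1), w ((Fin.snoc Y a : Fin (N + 1) → P) j) * vol ((Fin.snoc Y a : Fin (N + 1) → P) j) ^ m j
            else 0 : ℝ) =
          (if Compat ov τ Y then ∏ j : Fin N, w (Y j) * vol (Y j) ^ m j else 0) *
            (if ov a (Y p) then w a * vol a ^ m N else 0) := by
        intro a _
        conv_lhs => rw [Fin.prod_univ_castSucc]
        simp only [Fin.snoc_castSucc, Fin.snoc_last, Fin.val_castSucc, Fin.val_last]
        by_cases hc : Compat ov τ Y
        · by_cases ha : ov a (Y p)
          · rw [if_pos ((compat_snoc_iff hτ hNpos Y a).2 ⟨hc, ha⟩), if_pos hc, if_pos ha]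
          · rw [if_neg (fun h => ha ((compat_snoc_iff hτ hNpos Y a).1 h).2), if_neg ha, mul_zero]
        · rw [if_neg (fun h => hc ((compat_snoc_iff hτ hNpos Y a).1 h).1), if_neg hc, zero_mul]
      rw [Finset.sum_congr rfl hfac, ← Finset.mul_sum, ← Finset.sum_filter]
      -- the vertex hypothesis at the parent polymer `Y p`
      have hin : ∑ a ∈ Q with ov a (Y p), w a * vol a ^ m N ≤ (m N).factorial * A * vol (Y p) := H1 _ hYp _
      have hnn : 0 ≤ (if Compat ov τ Y then ∏ j : Fin N, w (Y j) * vol (Y j) ^ m j else 0 : ℝ) :=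
        treeSum_summand_nonneg hw hvol m hY
      calc (if Compat ov τ Y then ∏ j : Fin N, w (Y j) * vol (Y j) ^ m j else 0 : ℝ) *
              ∑ a ∈ Q with ov a (Y p), w a * vol a ^ m N
          ≤ (if Compat ov τ Y then ∏ j : Fin N, w (Y j) * vol (Y j) ^ m j else 0 : ℝ) *
              ((m N).factorial * A * vol (Y p)) := mul_le_mul_of_nonneg_left hin hnn
        _ = (m N).factorial * A *
              (if Compat ov τ Y then ∏ j : Fin N, w (Y j) * vol (Y j) ^ m' j else 0 : ℝ) := by
            have hprod : (∏ j : Fin N, w (Y j) * vol (Y j) ^ m j) * vol (Y p) =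
                ∏ j : Fin N, w (Y j) * vol (Y j) ^ m' j := by
              have h1 : ∀ j : Fin N, w (Y j) * vol (Y j) ^ m' j =
                  (w (Y j) * vol (Y j) ^ m j) * (if j = p then vol (Y j) else 1) := by
                intro j
                have hjp : ((j : ℕ) = τ N) ↔ j = p := by rw [Fin.ext_iff]
                simp only [hm']
                by_cases hj : j = p
                · rw [if_pos (hjp.2 hj), if_pos hj, pow_succ, mul_assoc]
                · rw [if_neg (fun h => hj (hjp.1 h)), if_neg hj, mul_one]
              rw [Fintype.prod_congr _ _ h1]
              conv_rhs => rw [Finset.prod_mul_distrib]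
              simp only [Finset.prod_ite_eq', Finset.mem_univ, if_true]
            split_ifs
            · rw [← hprod]; ring
            · ring
    -- step 2: the induction hypothesis with the exponents `m'`, and the bookkeeping of the factorials
    have hih := ih m'
    have hbook : (∏ j : Fin N, ((m' j + childCount τ N j).factorial : ℝ)) * (m N).factorial =
        ∏ j : Fin (N + 1), ((m j + childCount τ (N + 1) j).factorial : ℝ) := by
      conv_rhs => rw [Fin.prod_univ_castSucc]
      simp only [Fin.val_castSucc, Fin.val_last, childCount_self hτ N, add_zero]
      congr 1
      refine Fintype.prod_congr _ _ fun j => ?_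
      congr 2
      rw [childCount_succ (τ := τ) N]
      simp only [hm', hNpos, true_and]
      by_cases h : (j : ℕ) = τ N
      · rw [if_pos h, if_pos h.symm]; ring
      · rw [if_neg h, if_neg (Ne.symm h)]; ring
    calc treeSum ov τ Q w vol (N + 1) m ≤ (m N).factorial * A * treeSum ov τ Q w vol N m' := hstep
      _ ≤ (m N).factorial * A * (A ^ N * B * ∏ j : Fin N, ((m' j + childCount τ N j).factorial : ℝ)) :=
          mul_le_mul_of_nonneg_left hih (mul_nonneg (Nat.cast_nonneg _) hA)
      _ = A ^ (N + 1) * B * ((∏ j : Fin N, ((m' j + childCount τ N j).factorial : ℝ)) * (m N).factorial) := by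
          ring
      _ = A ^ (N + 1) * B * ∏ j : Fin (N + 1), ((m j + childCount τ (N + 1) j).factorial : ℝ) := by
          rw [hbook]

end Ordered


/-! ## §2 From (sudsy) and (ninety) to the vertex and root hypotheses (L3457–3478) -/

section Sudsy

variable {P : Type*} {Q : Finset P} {ov : P → P → Prop} [DecidableRel ov] {dM vol : P → ℝ} {κ₀ K₀ : ℝ}

/-- `x^k ≤ k!·e^x` for `x ≥ 0` (the inequality behind *"|Y_j|_M^{d_j−1} ≤ (d_j−1)! e^{|Y_j|_M}"*). [folklore] -/
private theorem pow_le_factorial_mul_exp {x : ℝ} (hx : 0 ≤ x) (k : ℕ) :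
    x ^ k ≤ k.factorial * Real.exp x := by
  have h := Real.pow_div_factorial_le_exp (x := x) hx k
  rwa [div_le_iff₀ (by positivity), mul_comm] at h

/-- the pointwise estimate `e^{−2κ₀ d_M(X)} vol(X)^k ≤ k!·e^{κ₀}·e^{−κ₀ d_M(X)}` from `vol(X) ≤ κ₀(1 + d_M(X))`
(*"Here we used again |Y_j|_M ≤ κ₀(1 + d_M(Y_j))"*, L3467). [cite: Dimock2013, App. B Theorem cluster, proof step 4 (arXiv:1108.1335v2 TeX L3457–3468)] -/
theorem weight_mul_pow_le {X : P} (hvolX : 0 ≤ vol X) (hninetyX : vol X ≤ κ₀ * (1 + dM X)) (k : ℕ) :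
    Real.exp (-2 * κ₀ * dM X) * vol X ^ k ≤ k.factorial * Real.exp κ₀ * Real.exp (-κ₀ * dM X) := by
  have hexp : Real.exp (-2 * κ₀ * dM X) * Real.exp (κ₀ * (1 + dM X)) = Real.exp κ₀ * Real.exp (-κ₀ * dM X) := by
    rw [← Real.exp_add, ← Real.exp_add]
    congr 1
    ring
  calc Real.exp (-2 * κ₀ * dM X) * vol X ^ k
      ≤ Real.exp (-2 * κ₀ * dM X) * (k.factorial * Real.exp (vol X)) :=
        mul_le_mul_of_nonneg_left (pow_le_factorial_mul_exp hvolX k) (Real.exp_nonneg _)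
    _ ≤ Real.exp (-2 * κ₀ * dM X) * (k.factorial * Real.exp (κ₀ * (1 + dM X))) := by
        gcongr
    _ = k.factorial * (Real.exp (-2 * κ₀ * dM X) * Real.exp (κ₀ * (1 + dM X))) := by ring
    _ = k.factorial * Real.exp κ₀ * Real.exp (-κ₀ * dM X) := by rw [hexp, mul_assoc]

/-- **THE VERTEX ESTIMATE** (L3457–3468: *"Σ_{Y_j ∩ Y_τ(j) ≠ ∅} e^{−2κ₀d_M(Y_j)}|Y_j|_M^{d_j−1} ≤ (d_j−1)! Σ_{Y_j ∩
Y_τ(j) ≠ ∅} e^{−2κ₀d_M(Y_j)}e^{|Y_j|_M} ≤ (d_j−1)! K₀e^{κ₀}|Y_τ(j)| Here we used again |Y_j|_M ≤ κ₀(1 + d_M(Y_j))"*):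
from (sudsy) in the form `Σ_{X ∈ Q : X ov X'} e^{−κ₀ d_M(X)} ≤ K₀·vol(X')` and (ninety) `vol(X) ≤ κ₀(1 + d_M(X))` on
`Q`, the VERTEX HYPOTHESIS of `treeSum_le` holds for the weights `w = e^{−2κ₀ d_M}` with `A = K₀e^{κ₀}`.
[cite: Dimock2013, App. B Theorem cluster, proof step 4 (arXiv:1108.1335v2 TeX L3457–3468)] -/
theorem vertexHyp_of_sudsy (hvol : ∀ X ∈ Q, 0 ≤ vol X) (hninety : ∀ X ∈ Q, vol X ≤ κ₀ * (1 + dM X))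
    (hsudsy : ∀ X' ∈ Q, ∑ X ∈ Q with ov X X', Real.exp (-κ₀ * dM X) ≤ K₀ * vol X') :
    ∀ X' ∈ Q, ∀ k : ℕ, ∑ X ∈ Q with ov X X', Real.exp (-2 * κ₀ * dM X) * vol X ^ k ≤
      k.factorial * (K₀ * Real.exp κ₀) * vol X' := by
  intro X' hX' k
  calc ∑ X ∈ Q with ov X X', Real.exp (-2 * κ₀ * dM X) * vol X ^ k
      ≤ ∑ X ∈ Q with ov X X', k.factorial * Real.exp κ₀ * Real.exp (-κ₀ * dM X) :=
        Finset.sum_le_sum fun X hX =>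
          weight_mul_pow_le (hvol X (Finset.mem_filter.1 hX).1) (hninety X (Finset.mem_filter.1 hX).1) k
    _ = k.factorial * Real.exp κ₀ * ∑ X ∈ Q with ov X X', Real.exp (-κ₀ * dM X) := by rw [Finset.mul_sum]
    _ ≤ k.factorial * Real.exp κ₀ * (K₀ * vol X') :=
        mul_le_mul_of_nonneg_left (hsudsy X' hX') (by positivity)
    _ = k.factorial * (K₀ * Real.exp κ₀) * vol X' := by ring

omit [DecidableRel ov] in
/-- **THE ROOT ESTIMATE** (L3470–3478: *"The last step is Σ_{Y_1 ⊂ Y} e^{−2κ₀d_M(Y_1)}|Y_1|_M^{d_1−1} ≤ (d_1−1)!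
Σ_{Y_1 ⊂ Y} e^{−2κ₀d_M(Y_j)}e^{|Y_1|_M} ≤ (d_1−1)! K₀e^{κ₀}|Y|_M ≤ (d_1−1)! K₀κ₀e^{κ₀}e^{d_M(Y)}"*): if all of `Q`
meets the ambient polymer `Y` ((sudsy): `Σ_{X∈Q} e^{−κ₀ d_M(X)} ≤ K₀·|Y|_M`) and `|Y|_M ≤ κ₀(1 + d_M(Y))`, the ROOT
HYPOTHESIS of `treeSum_le` holds with `A = K₀e^{κ₀}` and `B = κ₀e^{d_M(Y)}` (using `1 + x ≤ e^x`).
[cite: Dimock2013, App. B Theorem cluster, proof step 4 (arXiv:1108.1335v2 TeX L3470–3478)] -/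
theorem rootHyp_of_sudsy (hvol : ∀ X ∈ Q, 0 ≤ vol X) (hninety : ∀ X ∈ Q, vol X ≤ κ₀ * (1 + dM X))
    (hκ₀ : 0 ≤ κ₀) (hK₀ : 0 ≤ K₀) {volY dY : ℝ} (hY : volY ≤ κ₀ * (1 + dY))
    (hsudsyY : ∑ X ∈ Q, Real.exp (-κ₀ * dM X) ≤ K₀ * volY) :
    ∀ k : ℕ, ∑ X ∈ Q, Real.exp (-2 * κ₀ * dM X) * vol X ^ k ≤
      k.factorial * (K₀ * Real.exp κ₀) * (κ₀ * Real.exp dY) := by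
  intro k
  have hY' : volY ≤ κ₀ * Real.exp dY :=
    hY.trans (mul_le_mul_of_nonneg_left (by linarith [Real.add_one_le_exp dY]) hκ₀)
  calc ∑ X ∈ Q, Real.exp (-2 * κ₀ * dM X) * vol X ^ k
      ≤ ∑ X ∈ Q, k.factorial * Real.exp κ₀ * Real.exp (-κ₀ * dM X) :=
        Finset.sum_le_sum fun X hX => weight_mul_pow_le (hvol X hX) (hninety X hX) k
    _ = k.factorial * Real.exp κ₀ * ∑ X ∈ Q, Real.exp (-κ₀ * dM X) := by rw [Finset.mul_sum]
    _ ≤ k.factorial * Real.exp κ₀ * (K₀ * (κ₀ * Real.exp dY)) :=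
        mul_le_mul_of_nonneg_left (hsudsyY.trans (mul_le_mul_of_nonneg_left hY' hK₀)) (by positivity)
    _ = k.factorial * (K₀ * Real.exp κ₀) * (κ₀ * Real.exp dY) := by ring

end Sudsy

/-! ## §3 Relabeling: every tree graph is an ordered one after a permutation of the indices (L3449) -/

section Relabel

open Literature.Combinatorics.Enumerative (IsForestOn)

variable {n : ℕ} [NeZero n] {t : Fin n → Fin n}

/-- every index reaches the root `0` under iteration of the parent map. [folklore] -/
private theorem exists_iterate_eq_root (ht : IsForestOn (univ : Finset (Fin n)) {0} t) (u : Fin n) :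
    ∃ k, t^[k] u = 0 := by
  obtain ⟨k, hk⟩ := ht.2 u (Finset.mem_univ u)
  exact ⟨k, Finset.mem_singleton.1 hk⟩

/-- the depth of a vertex: the first hitting time of the root. [folklore] -/
private def depth (ht : IsForestOn (univ : Finset (Fin n)) {0} t) (u : Fin n) : ℕ :=
  Nat.find (exists_iterate_eq_root ht u)

/-- the walk from `u` is at the root at time `depth u`. [folklore] -/
private theorem iterate_depth (ht : IsForestOn (univ : Finset (Fin n)) {0} t) (u : Fin n) :
    t^[depth ht u] u = 0 :=
  Nat.find_spec (exists_iterate_eq_root ht u)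

/-- only the root has depth `0`. [folklore] -/
private theorem depth_eq_zero_iff (ht : IsForestOn (univ : Finset (Fin n)) {0} t) {u : Fin n} :
    depth ht u = 0 ↔ u = 0 := by
  constructor
  · intro h
    have := iterate_depth ht u
    rwa [h, Function.iterate_zero, id_eq] at this
  · rintro rfl
    exact (Nat.find_eq_zero _).2 rfl

/-- the parent of a non-root index is strictly less deep. [folklore] -/
private theorem depth_apply_lt (ht : IsForestOn (univ : Finset (Fin n)) {0} t) {u : Fin n} (hu : u ≠ 0) :
    depth ht (t u) < depth ht u := by
  have hpos : depth ht u ≠ 0 := fun h => hu ((depth_eq_zero_iff ht).1 h)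
  obtain ⟨d, hd⟩ : ∃ d, depth ht u = d + 1 := ⟨depth ht u - 1, by omega⟩
  have h1 : t^[d + 1] u = 0 := hd ▸ iterate_depth ht u
  rw [Function.iterate_succ_apply] at h1
  calc depth ht (t u) ≤ d := Nat.find_le h1
    _ < depth ht u := by omega

/-- **RELABELING** (L3450–3451: *"After relabeling a tree graph τ can be thought of as a map τ from (1, …, n) to
itself such that τ(j) < j"*): for every tree graph on the indices `Fin n` rooted at `0` (parent map `t`,
`CayleyForests.IsForestOn univ {0} t`) there is a permutation `σ` of the indices fixing the root such that the
conjugate parent map `σ⁻¹ ∘ t ∘ σ` decreases every non-root index — sort the indices by depth (`Tuple.sort`).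
[cite: Dimock2013, App. B Theorem cluster, proof step 4 (arXiv:1108.1335v2 TeX L3450–3451)] -/
theorem exists_relabel (ht : IsForestOn (univ : Finset (Fin n)) {0} t) :
    ∃ σ : Equiv.Perm (Fin n), σ 0 = 0 ∧ ∀ j, j ≠ 0 → σ.symm (t (σ j)) < j := by
  have hmono := Tuple.monotone_sort (depth ht)
  set σ := Tuple.sort (depth ht) with hσ
  have hσ0 : σ 0 = 0 := by
    have h0 : depth ht (σ 0) ≤ depth ht (σ (σ.symm 0)) := hmono (Fin.zero_le _)
    rw [Equiv.apply_symm_apply, (depth_eq_zero_iff ht).2 rfl, Nat.le_zero] at h0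
    exact (depth_eq_zero_iff ht).1 h0
  refine ⟨σ, hσ0, fun j hj => ?_⟩
  by_contra hlt
  rw [not_lt] at hlt
  have h1 : depth ht (σ j) ≤ depth ht (σ (σ.symm (t (σ j)))) := hmono hlt
  rw [Equiv.apply_symm_apply] at h1
  have hne : σ j ≠ 0 := fun h => hj (σ.injective (h.trans hσ0.symm))
  exact absurd (depth_apply_lt ht hne) (not_lt.2 h1)

end Relabel

/-! ## §4 The summation over the tuples compatible with any tree graph, and step 4's bound on the `n`-th term -/

section Assembly

open Literature.Combinatorics.Enumerative (IsForestOn forests mem_forests forests_self children mem_children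
  children_subset)
open Literature.Combinatorics.Enumerative.CayleyDegreeFormula (degree degree_sub_one children_root_nonempty
  sum_trees_prod_factorial_le)

variable {P : Type*} {ov : P → P → Prop} [DecidableRel ov] {Q : Finset P} {w vol : P → ℝ} {n : ℕ} [NeZero n]

/-- **THE SUMMATION OVER THE TUPLES COMPATIBLE WITH ANY TREE GRAPH** on the indices `Fin n` (`n ≥ 1`, root `0`,
parent map `t`): under the hypotheses of `treeSum_le`, `Σ_{(Y_j) ∈ Q^n : Y_u ov Y_{t(u)} ∀ u ≠ 0} Π_j w(Y_j)
vol(Y_j)^{m_j} ≤ A^n·B·Π_u (m_u + #children(u))!` — `treeSum_le` after RELABELING (`exists_relabel`; the sum, the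
exponents and the child counts are transported along the permutation).
[cite: Dimock2013, App. B Theorem cluster, proof step 4 (arXiv:1108.1335v2 TeX L3450–3484)] -/
theorem sum_compat_le {t : Fin n → Fin n} (ht : IsForestOn (univ : Finset (Fin n)) {0} t)
    (hw : ∀ X ∈ Q, 0 ≤ w X) (hvol : ∀ X ∈ Q, 0 ≤ vol X) {A B : ℝ} (hA : 0 ≤ A)
    (H1 : ∀ X' ∈ Q, ∀ k : ℕ, ∑ X ∈ Q with ov X X', w X * vol X ^ k ≤ k.factorial * A * vol X')
    (H0 : ∀ k : ℕ, ∑ X ∈ Q, w X * vol X ^ k ≤ k.factorial * A * B) (m : Fin n → ℕ) :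
    ∑ Y ∈ Fintype.piFinset (fun _ : Fin n => Q),
        (if ∀ u : Fin n, u ≠ 0 → ov (Y u) (Y (t u)) then ∏ j, w (Y j) * vol (Y j) ^ m j else 0) ≤
      A ^ n * B * ∏ u : Fin n, ((m u + (children univ {0} u t).card).factorial : ℝ) := by
  obtain ⟨n, rfl⟩ : ∃ n', n = n' + 1 := ⟨n - 1, (Nat.succ_pred_eq_of_ne_zero (NeZero.ne n)).symm⟩
  obtain ⟨σ, hσ0, hσ⟩ := exists_relabel ht
  have hne_iff : ∀ i : Fin (n + 1), σ i ≠ 0 ↔ i ≠ 0 := fun i =>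
    ⟨fun h hi => h (by rw [hi, hσ0]), fun h hσi => h (σ.injective (hσi.trans hσ0.symm))⟩
  have hpos_iff : ∀ i : Fin (n + 1), 0 < (i : ℕ) ↔ i ≠ 0 := fun i => by
    rw [← Fin.pos_iff_ne_zero, Fin.lt_def, Fin.val_zero]
  -- the ordered tree graph conjugate to `t`, and the transported exponents
  let τ : ℕ → ℕ := fun k => if h : k < n + 1 then ((σ.symm (t (σ ⟨k, h⟩)) : Fin (n + 1)) : ℕ) else 0
  have hτj : ∀ j : Fin (n + 1), τ j = ((σ.symm (t (σ j))) : ℕ) := fun j => dif_pos j.isLt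
  have hτ : ∀ j, 0 < j → τ j < j := by
    intro j hj
    by_cases h : j < n + 1
    · have hne : (⟨j, h⟩ : Fin (n + 1)) ≠ 0 := (hpos_iff ⟨j, h⟩).1 hj
      have := hσ ⟨j, h⟩ hne
      rw [Fin.lt_def] at this
      rwa [hτj ⟨j, h⟩]
    · rw [show τ j = 0 from dif_neg h]
      exact hj
  let m' : ℕ → ℕ := fun k => if h : k < n + 1 then m (σ ⟨k, h⟩) else 0
  have hm'j : ∀ j : Fin (n + 1), m' j = m (σ j) := fun j => dif_pos j.isLt
  -- (a) reindexing the tuples by `σ` turns the sum into the tree sum of `τ` with exponents `m'`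
  let e : (Fin (n + 1) → P) ≃ (Fin (n + 1) → P) :=
    { toFun := fun Y => Y ∘ σ
      invFun := fun Y => Y ∘ σ.symm
      left_inv := fun Y => by ext j; simp
      right_inv := fun Y => by ext j; simp }
  have hsum : (∑ Y ∈ Fintype.piFinset (fun _ : Fin (n + 1) => Q),
        (if ∀ u : Fin (n + 1), u ≠ 0 → ov (Y u) (Y (t u)) then ∏ j, w (Y j) * vol (Y j) ^ m j else 0)) =
      treeSum ov τ Q w vol (n + 1) m' := by
    unfold treeSum
    refine Finset.sum_equiv e (fun Y => ?_) (fun Y _ => ?_)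
    · simp only [Fintype.mem_piFinset, e, Equiv.coe_fn_mk, Function.comp_apply]
      exact ⟨fun h j => h (σ j), fun h j => by simpa using h (σ.symm j)⟩
    · have hc : (∀ u : Fin (n + 1), u ≠ 0 → ov (Y u) (Y (t u))) ↔ Compat ov τ (e Y) := by
        simp only [e, Equiv.coe_fn_mk, Compat, Function.comp_apply]
        constructor
        · intro H i j hj hij
          rw [hτj, ← Fin.ext_iff] at hij
          rw [← hij, Equiv.apply_symm_apply]
          exact H (σ j) ((hne_iff j).2 ((hpos_iff j).1 hj))
        · intro C u hu
          have hj : 0 < ((σ.symm u : Fin (n + 1)) : ℕ) := by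
            rw [hpos_iff, ← hne_iff, Equiv.apply_symm_apply]
            exact hu
          have := C (σ.symm (t u)) (σ.symm u) hj (by rw [hτj, Equiv.apply_symm_apply])
          simpa using this
      have hp : ∏ j, w (Y j) * vol (Y j) ^ m j = ∏ j, w (e Y j) * vol (e Y j) ^ m' j := by
        simp only [e, Equiv.coe_fn_mk, Function.comp_apply]
        rw [← Equiv.prod_comp σ (fun u => w (Y u) * vol (Y u) ^ m u)]
        exact Fintype.prod_congr _ _ fun j => by rw [hm'j]
      exact if_congr hc hp rfl
  -- (b) the child counts of `τ` are those of `t`, transported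
  have hcc : ∀ j : Fin (n + 1), childCount τ (n + 1) j = (children univ {0} (σ j) t).card := by
    intro j
    unfold childCount
    refine Finset.card_equiv σ fun i => ?_
    simp only [Finset.mem_filter, Finset.mem_univ, true_and, mem_children, Finset.mem_singleton]
    rw [hτj i, hpos_iff, ← hne_iff i, ← Fin.ext_iff, Equiv.symm_apply_eq]
  -- (c) assemble
  calc (∑ Y ∈ Fintype.piFinset (fun _ : Fin (n + 1) => Q),
        (if ∀ u : Fin (n + 1), u ≠ 0 → ov (Y u) (Y (t u)) then ∏ j, w (Y j) * vol (Y j) ^ m j else 0))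
      = treeSum ov τ Q w vol (n + 1) m' := hsum
    _ ≤ A ^ (n + 1) * B * ∏ j : Fin (n + 1), ((m' j + childCount τ (n + 1) j).factorial : ℝ) :=
        treeSum_le hτ hw hvol hA H1 H0 n m'
    _ = A ^ (n + 1) * B * ∏ u : Fin (n + 1), ((m u + (children univ {0} u t).card).factorial : ℝ) := by
        congr 1
        rw [← Equiv.prod_comp σ (fun u => (((m u + (children univ {0} u t).card).factorial : ℕ) : ℝ))]
        exact Fintype.prod_congr _ _ fun j => by rw [hm'j, hcc]

/-- pointwise: `Π_u #children(u)! = #children(v)·Π_u (d_u − 1)! ≤ (|V| − 1)·Π_u (d_u − 1)!` for a tree on `V`,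
`|V| ≥ 2`, rooted at `v` (`d_u` the incidence numbers, `CayleyDegreeFormula.degree`; AT THE ROOT the accumulated
factorial is `d_v!`, not `(d_v − 1)!`). [cite: Dimock2013, App. B Theorem cluster, proof step 4 (arXiv:1108.1335v2 TeX L3457–3484)] -/
theorem prod_card_children_factorial_le {α : Type*} [DecidableEq α] [Fintype α] {V : Finset α} {v : α}
    (hv : v ∈ V) (h2 : 2 ≤ V.card) {t : α → α} (ht : IsForestOn V {v} t) :
    ∏ u ∈ V, (children V {v} u t).card.factorial ≤ (V.card - 1) * ∏ u ∈ V, (degree V v t u - 1).factorial := by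
  obtain ⟨u, huV, huv⟩ : ∃ u ∈ V, u ≠ v := Finset.exists_mem_ne h2 v
  have hcpos : 0 < (children V {v} v t).card := Finset.card_pos.2 (children_root_nonempty ht hv huV huv)
  have hcle : (children V {v} v t).card ≤ V.card - 1 := by
    calc (children V {v} v t).card ≤ (V \ {v}).card := Finset.card_le_card (children_subset t)
      _ = V.card - 1 := by rw [Finset.sdiff_singleton_eq_erase, Finset.card_erase_of_mem hv]
  rw [← Finset.mul_prod_erase V _ hv, ← Finset.mul_prod_erase V (fun u => (degree V v t u - 1).factorial) hv]
  have hrest : ∏ u ∈ V.erase v, (children V {v} u t).card.factorial =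
      ∏ u ∈ V.erase v, (degree V v t u - 1).factorial := by
    refine Finset.prod_congr rfl fun u hu => ?_
    rw [degree_sub_one, if_neg (Finset.ne_of_mem_erase hu)]
  rw [hrest, degree_sub_one, if_pos rfl, ← mul_assoc]
  refine Nat.mul_le_mul_right _ ?_
  calc (children V {v} v t).card.factorial
      = (children V {v} v t).card * ((children V {v} v t).card - 1).factorial :=
        (Nat.mul_factorial_pred hcpos.ne').symm
    _ ≤ (V.card - 1) * ((children V {v} v t).card - 1).factorial := Nat.mul_le_mul_right _ hcle

/-- **(spit1)'s TREE FACTOR SUMMED BY (spit2)**: over ALL tree graphs on a vertex set `V` rooted at `v ∈ V` (parent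
maps), `Σ_τ Π_{u∈V} #children_u(τ)! ≤ (|V| − 1)!·4^{|V|−1}` — pointwise `Π_u #children_u! ≤ (|V|−1)·Π_u (d_u − 1)!`
(`prod_card_children_factorial_le`) and Dimock's (spit2) *"Σ_τ Π_{j=1}^n (d_j−1)! ≤ (n−2)! 4^{n−1}"*
(`CayleyDegreeFormula.sum_trees_prod_factorial_le`). [cite: Dimock2013, App. B Theorem cluster, proof step 4 eqs. (spit1)–(spit2) (arXiv:1108.1335v2 TeX L3480–3500)] -/
theorem sum_forests_prod_card_children_factorial_le {α : Type*} [DecidableEq α] [Fintype α] (V : Finset α)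
    {v : α} (hv : v ∈ V) :
    ∑ t ∈ forests V {v}, ∏ u ∈ V, (children V {v} u t).card.factorial ≤
      (V.card - 1).factorial * 4 ^ (V.card - 1) := by
  by_cases h2 : 2 ≤ V.card
  · calc ∑ t ∈ forests V {v}, ∏ u ∈ V, (children V {v} u t).card.factorial
        ≤ ∑ t ∈ forests V {v}, (V.card - 1) * ∏ u ∈ V, (degree V v t u - 1).factorial :=
          Finset.sum_le_sum fun t ht => prod_card_children_factorial_le hv h2 (mem_forests.1 ht)
      _ = (V.card - 1) * ∑ t ∈ forests V {v}, ∏ u ∈ V, (degree V v t u - 1).factorial := by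
          rw [Finset.mul_sum]
      _ ≤ (V.card - 1) * ((V.card - 2).factorial * 4 ^ (V.card - 1)) :=
          Nat.mul_le_mul_left _ (sum_trees_prod_factorial_le hv h2)
      _ = (V.card - 1).factorial * 4 ^ (V.card - 1) := by
          rw [← mul_assoc]
          congr 1
          rw [show V.card - 2 = V.card - 1 - 1 by omega, Nat.mul_factorial_pred (by omega)]
  · have hV : V = {v} := by
      have h1 : V.card = 1 := by have := Finset.card_pos.2 ⟨v, hv⟩; omega
      obtain ⟨a, ha⟩ := Finset.card_eq_one.1 h1
      rw [ha] at hv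
      rw [ha, Finset.mem_singleton.1 hv]
    subst hV
    have hch : children ({v} : Finset α) {v} v id = ∅ :=
      Finset.subset_empty.1 ((children_subset id).trans (by simp))
    rw [forests_self, Finset.sum_singleton, Finset.prod_singleton, hch]
    simp

open UrsellTreeGraphBound (overlapGraph rhoT treeGraphs abs_rhoT_le_card_treeGraphs)

/-- **STEP 4's BOUND ON THE `n`-TH TERM OF (hstar)** ((sundry) L3416–3426, (spit1) L3480–3484, (spit2)): for cube-set
polymers `Q`, weights `w ≥ 0`, volumes `vol ≥ 0` and constants `A, B ≥ 0` with the vertex hypothesis for the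
overlap relation `X ∩ X' ≠ ∅` and the root hypothesis (`treeSum_le`; Dimock: `w = e^{−2κ₀d_M}`, `A = K₀e^{κ₀}`,
`B = κ₀e^{d_M(Y)}`, §2), the sum over ALL `n`-tuples (`n ≥ 1`) of `|ρ^T(Y_1, …, Y_n)|·Π_j w(Y_j)` is at most
`A^n·B·(n−1)!·4^{n−1}`: *"|ρ^T(Y_1,…,Y_n)| ≤ number of tree graphs contained in g"* (`UrsellTreeGraphBound.abs_rhoT_le_card_treeGraphs`),
exchange of the sums over tuples and tree graphs ((sundry)), `sum_compat_le` for each tree graph, and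
`sum_forests_prod_card_children_factorial_le`.  (Dimock prints `(O(1)H₀)^n Σ_τ Π_j (d_j−1)!` with (spit2) `≤ (n−2)!
4^{n−1}`; with the root's factor `d_1!` the tree factor is `Σ_τ d_1 Π_j (d_j−1)! ≤ (n−1)!4^{n−1}` — module
docstring INFO.) [cite: Dimock2013, App. B Theorem cluster, proof step 4 (arXiv:1108.1335v2 TeX L3405–3500)] -/
theorem sum_abs_rhoT_mul_prod_le {C : Type*} [DecidableEq C] {Q : Finset (Finset C)} {w vol : Finset C → ℝ}
    (hw : ∀ X ∈ Q, 0 ≤ w X) (hvol : ∀ X ∈ Q, 0 ≤ vol X) {A B : ℝ} (hA : 0 ≤ A) (hB : 0 ≤ B)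
    (H1 : ∀ X' ∈ Q, ∀ k : ℕ, ∑ X ∈ Q with ¬ Disjoint X X', w X * vol X ^ k ≤ k.factorial * A * vol X')
    (H0 : ∀ k : ℕ, ∑ X ∈ Q, w X * vol X ^ k ≤ k.factorial * A * B) :
    ∑ Y ∈ Fintype.piFinset (fun _ : Fin n => Q), |(rhoT Y univ : ℝ)| * ∏ j, w (Y j) ≤
      A ^ n * B * ((n - 1).factorial * 4 ^ (n - 1) : ℕ) := by
  -- |ρ^T| ≤ #treeGraphs, written as a sum of indicators over all tree graphs rooted at `0`
  have h1 : ∀ Y ∈ Fintype.piFinset (fun _ : Fin n => Q), |(rhoT Y univ : ℝ)| * ∏ j, w (Y j) ≤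
      ∑ t ∈ forests (univ : Finset (Fin n)) {0},
        (if ∀ u : Fin n, u ≠ 0 → ¬ Disjoint (Y u) (Y (t u)) then ∏ j, w (Y j) * vol (Y j) ^ (0 : ℕ) else 0) := by
    intro Y hY
    have hnn : 0 ≤ ∏ j, w (Y j) := Finset.prod_nonneg fun j _ => hw _ (Fintype.mem_piFinset.1 hY j)
    have hρ : |(rhoT Y univ : ℝ)| ≤ ((treeGraphs (overlapGraph Y) univ 0).card : ℝ) := by
      have := abs_rhoT_le_card_treeGraphs Y (I := univ) (Finset.mem_univ (0 : Fin n))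
      exact_mod_cast this
    calc |(rhoT Y univ : ℝ)| * ∏ j, w (Y j) ≤ (treeGraphs (overlapGraph Y) univ 0).card * ∏ j, w (Y j) :=
          mul_le_mul_of_nonneg_right hρ hnn
      _ = ∑ t ∈ forests univ {0},
            (if ∀ u : Fin n, u ≠ 0 → ¬ Disjoint (Y u) (Y (t u)) then ∏ j, w (Y j) * vol (Y j) ^ (0 : ℕ) else 0) := by
          rw [treeGraphs, Finset.card_filter, Nat.cast_sum, Finset.sum_mul]
          refine Finset.sum_congr rfl fun t _ => ?_
          simp only [overlapGraph, Finset.mem_erase, Finset.mem_univ, and_true, pow_zero, mul_one]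
          by_cases hc : ∀ u : Fin n, u ≠ 0 → ¬ Disjoint (Y u) (Y (t u))
          · rw [if_pos hc, if_pos hc]; simp
          · rw [if_neg hc, if_neg hc]; simp
  have h4 := sum_forests_prod_card_children_factorial_le (univ : Finset (Fin n)) (Finset.mem_univ (0 : Fin n))
  rw [Finset.card_univ, Fintype.card_fin] at h4
  calc ∑ Y ∈ Fintype.piFinset (fun _ : Fin n => Q), |(rhoT Y univ : ℝ)| * ∏ j, w (Y j)
      ≤ ∑ Y ∈ Fintype.piFinset (fun _ : Fin n => Q), ∑ t ∈ forests (univ : Finset (Fin n)) {0},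
          (if ∀ u : Fin n, u ≠ 0 → ¬ Disjoint (Y u) (Y (t u)) then ∏ j, w (Y j) * vol (Y j) ^ (0 : ℕ) else 0) :=
        Finset.sum_le_sum h1
    _ = ∑ t ∈ forests (univ : Finset (Fin n)) {0}, ∑ Y ∈ Fintype.piFinset (fun _ : Fin n => Q),
          (if ∀ u : Fin n, u ≠ 0 → ¬ Disjoint (Y u) (Y (t u)) then ∏ j, w (Y j) * vol (Y j) ^ (0 : ℕ) else 0) :=
        Finset.sum_comm
    _ ≤ ∑ t ∈ forests (univ : Finset (Fin n)) {0},
          A ^ n * B * ∏ u : Fin n, (((fun _ => 0 : Fin n → ℕ) u + (children univ {0} u t).card).factorial : ℝ) :=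
        Finset.sum_le_sum fun t ht =>
          sum_compat_le (ov := fun X X' => ¬ Disjoint X X') (mem_forests.1 ht) hw hvol hA H1 H0 (fun _ => 0)
    _ = A ^ n * B * ((∑ t ∈ forests (univ : Finset (Fin n)) {0},
          ∏ u : Fin n, (children univ {0} u t).card.factorial : ℕ) : ℝ) := by
        rw [← Finset.mul_sum]
        simp
    _ ≤ A ^ n * B * ((n - 1).factorial * 4 ^ (n - 1) : ℕ) :=
        mul_le_mul_of_nonneg_left (Nat.cast_le.2 h4) (mul_nonneg (pow_nonneg hA n) hB)

/-- **DIMOCK'S INSTANCE** of `sum_abs_rhoT_mul_prod_le` (the chain (sudsy) → vertex ∕ root estimates → (spit1),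
L3450–3484): for cube-set polymers `Q` (those inside the ambient `Y`) with `|X|_M ≤ κ₀(1 + d_M(X))` ((ninety)),
(sudsy) `Σ_{X ∈ Q: X ∩ X' ≠ ∅} e^{−κ₀d_M(X)} ≤ K₀|X'|_M` on `Q` and `Σ_{X∈Q} e^{−κ₀d_M(X)} ≤ K₀|Y|_M`, `|Y|_M ≤
κ₀(1 + d_M(Y))`, `κ₀, K₀ ≥ 0`: `Σ_{(Y_j) ∈ Q^n} |ρ^T(Y_1,…,Y_n)| Π_j e^{−2κ₀ d_M(Y_j)} ≤ (K₀e^{κ₀})^n · κ₀e^{d_M(Y)}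
· (n−1)!·4^{n−1}`. [cite: Dimock2013, App. B Theorem cluster, proof step 4 (arXiv:1108.1335v2 TeX L3450–3500)] -/
theorem step4_term_le {C : Type*} [DecidableEq C] {Q : Finset (Finset C)} {dM vol : Finset C → ℝ} {κ₀ K₀ : ℝ}
    (hκ₀ : 0 ≤ κ₀) (hK₀ : 0 ≤ K₀) (hvol : ∀ X ∈ Q, 0 ≤ vol X) (hninety : ∀ X ∈ Q, vol X ≤ κ₀ * (1 + dM X))
    (hsudsy : ∀ X' ∈ Q, ∑ X ∈ Q with ¬ Disjoint X X', Real.exp (-κ₀ * dM X) ≤ K₀ * vol X')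
    {volY dY : ℝ} (hY : volY ≤ κ₀ * (1 + dY)) (hsudsyY : ∑ X ∈ Q, Real.exp (-κ₀ * dM X) ≤ K₀ * volY) :
    ∑ Y ∈ Fintype.piFinset (fun _ : Fin n => Q), |(rhoT Y univ : ℝ)| * ∏ j, Real.exp (-2 * κ₀ * dM (Y j)) ≤
      (K₀ * Real.exp κ₀) ^ n * (κ₀ * Real.exp dY) * ((n - 1).factorial * 4 ^ (n - 1) : ℕ) :=
  sum_abs_rhoT_mul_prod_le (fun X _ => Real.exp_nonneg _) hvol (by positivity) (by positivity)
    (vertexHyp_of_sudsy hvol hninety hsudsy) (rootHyp_of_sudsy hvol hninety hκ₀ hK₀ hY hsudsyY)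

/-- **"DIVIDE BY n! AND SUM OVER n"** (L3504–3509: *"Now use (spit2) in (spit1), divide by n! and sum over n to get a
bound on H^#(Y). We have |H^#(Y)| ≤ e^{−(κ₂−2κ₀−1)d_M(Y)} Σ_{n=1}^∞ (O(1)H₀)^n ≤ O(1)H₀ e^{−(κ₂−2κ₀−1)d_M(Y)} provided
H₀ ≤ c₀ and c₀ is sufficiently small"*), abstractly: under the hypotheses of `sum_abs_rhoT_mul_prod_le` and `A ≤
1/8`, every partial sum of `Σ_{n≥1} (1/n!) Σ_{(Y_j)∈Q^n} |ρ^T(Y_1,…,Y_n)| Π_j w(Y_j)` is at most `2AB` (the `n`-th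
term is at most `A·B·(4A)^{n−1}`, a geometric series). [cite: Dimock2013, App. B Theorem cluster, proof step 4 (arXiv:1108.1335v2 TeX L3504–3511)] -/
theorem hstar_partialSum_le {C : Type*} [DecidableEq C] {Q : Finset (Finset C)} {w vol : Finset C → ℝ}
    (hw : ∀ X ∈ Q, 0 ≤ w X) (hvol : ∀ X ∈ Q, 0 ≤ vol X) {A B : ℝ} (hA : 0 ≤ A) (hB : 0 ≤ B) (hA8 : A ≤ 1 / 8)
    (H1 : ∀ X' ∈ Q, ∀ k : ℕ, ∑ X ∈ Q with ¬ Disjoint X X', w X * vol X ^ k ≤ k.factorial * A * vol X')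
    (H0 : ∀ k : ℕ, ∑ X ∈ Q, w X * vol X ^ k ≤ k.factorial * A * B) (N : ℕ) :
    ∑ n ∈ Finset.range N, (1 / ((n + 1).factorial : ℝ)) *
        ∑ Y ∈ Fintype.piFinset (fun _ : Fin (n + 1) => Q), |(rhoT Y univ : ℝ)| * ∏ j, w (Y j) ≤ 2 * A * B := by
  have hterm : ∀ n : ℕ, (1 / ((n + 1).factorial : ℝ)) *
      ∑ Y ∈ Fintype.piFinset (fun _ : Fin (n + 1) => Q), |(rhoT Y univ : ℝ)| * ∏ j, w (Y j) ≤
        A * B * (4 * A) ^ n := by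
    intro n
    have h := sum_abs_rhoT_mul_prod_le (n := n + 1) hw hvol hA hB H1 H0
    simp only [Nat.add_sub_cancel] at h
    calc (1 / ((n + 1).factorial : ℝ)) *
          ∑ Y ∈ Fintype.piFinset (fun _ : Fin (n + 1) => Q), |(rhoT Y univ : ℝ)| * ∏ j, w (Y j)
        ≤ (1 / ((n + 1).factorial : ℝ)) * (A ^ (n + 1) * B * ((n.factorial * 4 ^ n : ℕ) : ℝ)) :=
          mul_le_mul_of_nonneg_left h (by positivity)
      _ = ((n.factorial : ℝ) / (n + 1).factorial) * (A * B * (4 * A) ^ n) := by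
          push_cast
          ring
      _ ≤ 1 * (A * B * (4 * A) ^ n) :=
          mul_le_mul_of_nonneg_right
            (div_le_one_of_le₀ (by exact_mod_cast Nat.factorial_le (Nat.le_succ n)) (by positivity))
            (by positivity)
      _ = A * B * (4 * A) ^ n := one_mul _
  have hgeom : ∑ n ∈ Finset.range N, (4 * A) ^ n ≤ 2 := by
    have hr : 4 * A ≤ 1 / 2 := by linarith
    calc ∑ n ∈ Finset.range N, (4 * A) ^ n ≤ ∑ n ∈ Finset.range N, (1 / 2 : ℝ) ^ n :=
          Finset.sum_le_sum fun n _ => pow_le_pow_left₀ (by positivity) hr n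
      _ = 2 - 2 * (1 / 2 : ℝ) ^ N := by
          rw [geom_sum_eq (by norm_num) N]
          ring
      _ ≤ 2 := by linarith [pow_nonneg (by norm_num : (0 : ℝ) ≤ 1 / 2) N]
  calc ∑ n ∈ Finset.range N, (1 / ((n + 1).factorial : ℝ)) *
          ∑ Y ∈ Fintype.piFinset (fun _ : Fin (n + 1) => Q), |(rhoT Y univ : ℝ)| * ∏ j, w (Y j)
      ≤ ∑ n ∈ Finset.range N, A * B * (4 * A) ^ n := Finset.sum_le_sum fun n _ => hterm n
    _ = A * B * ∑ n ∈ Finset.range N, (4 * A) ^ n := by rw [Finset.mul_sum]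
    _ ≤ A * B * 2 := mul_le_mul_of_nonneg_left hgeom (mul_nonneg hA hB)
    _ = 2 * A * B := by ring

end Assembly

/-! ## §5 (v1.1) The hypotheses from an ANCHORED bound — the mechanism of (sudsy)'s proof (App. A Cor. `cranberry`) -/

section Anchored

variable {C : Type*} [DecidableEq C] {Q : Finset (Finset C)} {f w : Finset C → ℝ}

/-- **(sudsy)'s PROOF SHAPE** (App. A = `\section{estimates}` Cor. `\label{cranberry}`, proof L3150–3156: *"The first
follows by Σ_{X: X ∩ Y ≠ ∅} e^{−a|X|} ≤ Σ_{□ ⊂ Y} Σ_{X ⊃ □} e^{−a|X|} ≤ b|Y|"*), abstractly: an ANCHORED bound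
`Σ_{X ∈ Q: q ∈ X} f(X) ≤ Φ` for every cube `q` gives, for `f ≥ 0`, the OVERLAP-SUM bound `Σ_{X ∈ Q: X ∩ X' ≠ ∅}
f(X) ≤ Φ·|X'|` (every `X` meeting `X'` contains one of the `|X'|` cubes of `X'`).
[cite: Dimock2013, App. A Corollary cranberry, proof (arXiv:1108.1335v2 TeX L3140–3156)] -/
theorem sum_overlap_le_of_anchored (hf : ∀ X ∈ Q, 0 ≤ f X) {Φ : ℝ}
    (hanch : ∀ q : C, ∑ X ∈ Q with q ∈ X, f X ≤ Φ) (X' : Finset C) :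
    ∑ X ∈ Q with ¬ Disjoint X X', f X ≤ Φ * X'.card := by
  -- each overlapping `X` is counted at least once among the anchors `q ∈ X'`
  have h1 : ∀ X ∈ Q.filter (fun X => ¬ Disjoint X X'),
      f X ≤ ∑ q ∈ X', if q ∈ X then f X else 0 := by
    intro X hX
    obtain ⟨hXQ, hov⟩ := Finset.mem_filter.1 hX
    obtain ⟨q, hqX, hqX'⟩ := Finset.not_disjoint_iff.1 hov
    calc f X = ∑ q ∈ ({q} : Finset C), if q ∈ X then f X else 0 := by simp [hqX]
      _ ≤ ∑ q ∈ X', if q ∈ X then f X else 0 :=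
          Finset.sum_le_sum_of_subset_of_nonneg (Finset.singleton_subset_iff.2 hqX')
            (fun q _ _ => by split_ifs <;> simp [hf X hXQ])
  calc ∑ X ∈ Q with ¬ Disjoint X X', f X
      ≤ ∑ X ∈ Q with ¬ Disjoint X X', ∑ q ∈ X', if q ∈ X then f X else 0 := Finset.sum_le_sum h1
    _ ≤ ∑ X ∈ Q, ∑ q ∈ X', if q ∈ X then f X else 0 :=
        Finset.sum_le_sum_of_subset_of_nonneg (Finset.filter_subset _ _)
          (fun X hX _ => Finset.sum_nonneg fun q _ => by split_ifs <;> simp [hf X hX])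
    _ = ∑ q ∈ X', ∑ X ∈ Q with q ∈ X, f X := by
        rw [Finset.sum_comm]
        exact Finset.sum_congr rfl fun q _ => (Finset.sum_filter _ _).symm
    _ ≤ ∑ q ∈ X', Φ := Finset.sum_le_sum fun q _ => hanch q
    _ = Φ * X'.card := by rw [Finset.sum_const, nsmul_eq_mul, mul_comm]

/-- the VERTEX HYPOTHESIS of `treeSum_le` ∕ `sum_abs_rhoT_mul_prod_le` (overlap relation `X ∩ X' ≠ ∅`, volume
`vol = |·|` = number of cubes) FROM AN ANCHORED EXPONENTIAL NORM `Σ_{X ∈ Q: q ∈ X} w(X)·e^{|X|} ≤ Φ` (every cube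
`q`), with `A = Φ`: (sudsy)'s mechanism (`sum_overlap_le_of_anchored`) and `|X|^k ≤ k!·e^{|X|}` (L3457–3468).  This
is the form in which the Bałaban-side activity norms are stated (the anchored sum over polymers containing a cube).
[cite: Dimock2013, App. B Theorem cluster, proof step 4 (arXiv:1108.1335v2 TeX L3457–3468) with App. A Corollary cranberry (L3140–3156)] -/
theorem vertexHyp_of_anchored (hw : ∀ X ∈ Q, 0 ≤ w X) {Φ : ℝ}
    (hanch : ∀ q : C, ∑ X ∈ Q with q ∈ X, w X * Real.exp (X.card : ℝ) ≤ Φ) :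
    ∀ X' ∈ Q, ∀ k : ℕ, ∑ X ∈ Q with ¬ Disjoint X X', w X * (X.card : ℝ) ^ k ≤
      k.factorial * Φ * (X'.card : ℝ) := by
  intro X' _ k
  have hf : ∀ X ∈ Q, 0 ≤ w X * Real.exp (X.card : ℝ) := fun X hX => mul_nonneg (hw X hX) (Real.exp_nonneg _)
  calc ∑ X ∈ Q with ¬ Disjoint X X', w X * (X.card : ℝ) ^ k
      ≤ ∑ X ∈ Q with ¬ Disjoint X X', k.factorial * (w X * Real.exp (X.card : ℝ)) :=
        Finset.sum_le_sum fun X hX => by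
          calc w X * (X.card : ℝ) ^ k ≤ w X * (k.factorial * Real.exp (X.card : ℝ)) :=
                mul_le_mul_of_nonneg_left (pow_le_factorial_mul_exp (Nat.cast_nonneg _) k)
                  (hw X (Finset.mem_filter.1 hX).1)
            _ = k.factorial * (w X * Real.exp (X.card : ℝ)) := by ring
    _ = k.factorial * ∑ X ∈ Q with ¬ Disjoint X X', w X * Real.exp (X.card : ℝ) := by rw [Finset.mul_sum]
    _ ≤ k.factorial * (Φ * X'.card) :=
        mul_le_mul_of_nonneg_left (sum_overlap_le_of_anchored hf hanch X') (Nat.cast_nonneg _)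
    _ = k.factorial * Φ * (X'.card : ℝ) := by ring

/-- the ROOT HYPOTHESIS from an anchored exponential norm, with `A = Φ` and `B = |Y|`, when every polymer of `Q` meets
the ambient `Y` (Dimock: the polymers inside `Y`; *"The last step is Σ_{Y_1 ⊂ Y} …"*, L3470–3478).
[cite: Dimock2013, App. B Theorem cluster, proof step 4 (arXiv:1108.1335v2 TeX L3470–3478) with App. A Corollary cranberry (L3140–3156)] -/
theorem rootHyp_of_anchored (hw : ∀ X ∈ Q, 0 ≤ w X) {Φ : ℝ}
    (hanch : ∀ q : C, ∑ X ∈ Q with q ∈ X, w X * Real.exp (X.card : ℝ) ≤ Φ) {Y : Finset C}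
    (hQY : ∀ X ∈ Q, ¬ Disjoint X Y) :
    ∀ k : ℕ, ∑ X ∈ Q, w X * (X.card : ℝ) ^ k ≤ k.factorial * Φ * (Y.card : ℝ) := by
  intro k
  have hf : ∀ X ∈ Q, 0 ≤ w X * Real.exp (X.card : ℝ) := fun X hX => mul_nonneg (hw X hX) (Real.exp_nonneg _)
  have hQ : Q.filter (fun X => ¬ Disjoint X Y) = Q := Finset.filter_true_of_mem hQY
  calc ∑ X ∈ Q, w X * (X.card : ℝ) ^ k
      ≤ ∑ X ∈ Q, k.factorial * (w X * Real.exp (X.card : ℝ)) :=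
        Finset.sum_le_sum fun X hX => by
          calc w X * (X.card : ℝ) ^ k ≤ w X * (k.factorial * Real.exp (X.card : ℝ)) :=
                mul_le_mul_of_nonneg_left (pow_le_factorial_mul_exp (Nat.cast_nonneg _) k) (hw X hX)
            _ = k.factorial * (w X * Real.exp (X.card : ℝ)) := by ring
    _ = k.factorial * ∑ X ∈ Q with ¬ Disjoint X Y, w X * Real.exp (X.card : ℝ) := by rw [Finset.mul_sum, hQ]
    _ ≤ k.factorial * (Φ * Y.card) :=
        mul_le_mul_of_nonneg_left (sum_overlap_le_of_anchored hf hanch Y) (Nat.cast_nonneg _)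
    _ = k.factorial * Φ * (Y.card : ℝ) := by ring

/-- **THE `n`-TH TERM FROM AN ANCHORED EXPONENTIAL NORM**: for cube-set polymers `Q` all meeting `Y`, weights `w ≥ 0`
with `Σ_{X ∈ Q: q ∈ X} w(X)e^{|X|} ≤ Φ` for every cube `q`: `Σ_{(Y_j)∈Q^n} |ρ^T(Y_1,…,Y_n)|·Π_j w(Y_j) ≤ Φ^n·|Y|·
(n−1)!·4^{n−1}` (`sum_abs_rhoT_mul_prod_le` with `vertexHyp_of_anchored`, `rootHyp_of_anchored`).
[cite: Dimock2013, App. B Theorem cluster, proof step 4 (arXiv:1108.1335v2 TeX L3405–3500) with App. A Corollary cranberry (L3140–3156)] -/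
theorem sum_abs_rhoT_mul_prod_le_of_anchored {n : ℕ} [NeZero n] (hw : ∀ X ∈ Q, 0 ≤ w X) {Φ : ℝ} (hΦ : 0 ≤ Φ)
    (hanch : ∀ q : C, ∑ X ∈ Q with q ∈ X, w X * Real.exp (X.card : ℝ) ≤ Φ) {Y : Finset C}
    (hQY : ∀ X ∈ Q, ¬ Disjoint X Y) :
    ∑ Z ∈ Fintype.piFinset (fun _ : Fin n => Q), |(UrsellTreeGraphBound.rhoT Z univ : ℝ)| * ∏ j, w (Z j) ≤
      Φ ^ n * (Y.card : ℝ) * ((n - 1).factorial * 4 ^ (n - 1) : ℕ) :=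
  sum_abs_rhoT_mul_prod_le hw (fun _ _ => Nat.cast_nonneg _) hΦ (Nat.cast_nonneg _)
    (vertexHyp_of_anchored hw hanch) (rootHyp_of_anchored hw hanch hQY)

end Anchored

end Literature.MathematicalPhysics.QuantumFieldTheory.Dimock2011to13.TreeGraphSummation
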